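import Summits.ResolutionOfSingularities.ResolutionOfSingularities.Theorems.StallVertexCompanion2
import HarnessLib

/-!
# StallVertexCompanion3 — decomp-res node «StallVertexCompanion (lens-5 g29, rev 10 of the node «StallVertex»;
critic row 192 CLEARED +1)», tree file 3/8 of the node

Content from the decomp-res lens-5 g29 node file `HOME/decomp-res-lens-5/g29/StallVertexCompanion.lean` (pin
deaa8fea) with the critic's ten mechanical lint fixes (fixed sha256 245dae5b; HOME =
run/shared/lean/pub/decomp-res); critic CRITIC-LEDGER row 192 CLEARED +1 — provenance, the fix list, critic text and
the lens header in full in part 2 of the node, `StallVertexCompanion`.  Namespace `…Theorems.StallVertex`;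
`--supports stmt-ResolutionOfSingularities-31770`.

## This file

Continuation 3/8 of `StallVertexCompanion` (same namespace and sections of the node, cut at the tree's 400-line cap;
section variables / opens replayed): `section AlgebraTangent` — carries `free_linear`, `add_X_mul_pow`,
`low_layer_of_cone`, `eq_single_of_three`.

[WRITER NOTE (decomp-res writer g12): file split only (tree files ≤ 400 lines) plus the ten critic-ordered lint
fixes listed in `StallVertexCompanion`; namespace, sections, section variables / opens / `set_option maxHeartbeats …
in` lines and every declaration otherwise exactly as in the lens.]

(Sources: KawanoueMatsuki2012 arXiv:1205.4556 Prop. 3 (the companion (c_{f,𝕆}·𝕄^{-a}, μ̃·a)); Moh1987; Hauser2010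
(kangaroo points); HauserPerlega2019 §2; HauserPerlega2024; CossartPiltant2008 §2; CossartJannsenSaito2020 Ch. 8;
Benito–Villamayor (monomial case); Hironaka2005.)
-/

noncomputable section

open MvPolynomial Finset
open Literature.AlgebraicGeometry.Resolution
open Literature.AlgebraicGeometry.Resolution.Hauser2010
open Literature.AlgebraicGeometry.Resolution.HauserPerlega2024
open Literature.Barriers.ResolutionOfSingularities
open Literature.AlgebraicGeometry.Resolution.PointBlowup
open Summit.ResolutionOfSingularities.ResolutionOfSingularities.Theses
open Summit.ResolutionOfSingularities.ResolutionOfSingularities.Theorems.TightDefectClasses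
open Summit.ResolutionOfSingularities.ResolutionOfSingularities.Theorems.ProximityCut
open Summit.ResolutionOfSingularities.ResolutionOfSingularities.Theorems.ExitLaw
open Summit.ResolutionOfSingularities.ResolutionOfSingularities.Theorems.DifferentialShade

namespace Summit.ResolutionOfSingularities.ResolutionOfSingularities.Theorems.StallVertex

section AlgebraTangent

variable {σ : Type*} {K : Type*} [Field K] [Fintype σ] [DecidableEq σ] [DecidableEq K]

omit [DecidableEq K] in
/-- A linear form with vanishing `u_j`-coefficient is `u_j`-free. [folklore] -/
theorem free_linear {j : σ} (c : σ → K) (hc : c j = 0) :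
    ∀ e ∈ (∑ i, C (c i) * X i : MvPolynomial σ K).support, e j = 0 := by
  classical
  intro e he
  by_contra hne
  apply MvPolynomial.mem_support_iff.mp he
  rw [coeff_sum]
  refine Finset.sum_eq_zero fun i _ => ?_
  rw [coeff_C_mul, coeff_X]
  split_ifs with h
  · have hij : i = j := by
      by_contra hij
      rw [← h, Finsupp.single_eq_of_ne (Ne.symm hij)] at hne
      exact hne rfl
    rw [hij, hc, zero_mul]
  · rw [mul_zero]

omit [Fintype σ] [DecidableEq σ] [DecidableEq K] in
/-- `(P + u_j Q)^n = P^n + u_j · R`. [folklore] -/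
theorem add_X_mul_pow (j : σ) (P Q : MvPolynomial σ K) (n : ℕ) :
    ∃ R : MvPolynomial σ K, (P + X j * Q) ^ n = P ^ n + X j * R := by
  induction n with
  | zero => exact ⟨0, by rw [pow_zero, pow_zero, mul_zero, add_zero]⟩
  | succ n ih =>
    obtain ⟨R, hR⟩ := ih
    exact ⟨R * (P + X j * Q) + P ^ n * Q, by rw [pow_succ, hR]; ring⟩

omit [DecidableEq K] in
/-- **A2 — THE LOW LAYER OF A TANGENT CONE.**  If the two-layer form `u_j^E (A + u_j B)` (`A` `u_j`-free) equals
`r' · u^{S'' + E·1_j} · H'^γ` (`S''` without `u_j`), then `A = r' · u^{S''} · (H'♭)^γ` with the CARRIED form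
`H'♭ = H'(u_j ↦ 0)`: the low layer of a pure-power cone is the pure power of the carried plane. [new] [folklore] -/
theorem low_layer_of_cone (j : σ) (E : ℕ) {A : MvPolynomial σ K} (B : MvPolynomial σ K)
    (hA : ∀ e ∈ A.support, e j = 0) (S'' : σ →₀ ℕ) (hS : S'' j = 0) (r' : K) (c' : σ → K) (γ : ℕ)
    (h : X j ^ E * (A + X j * B) = monomial (S'' + Finsupp.single j E) r' * (∑ i, C (c' i) * X i) ^ γ) :
    A = monomial S'' r' * (∑ i, C (Function.update c' j 0 i) * X i) ^ γ := by
  classical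
  obtain ⟨H, hH⟩ : ∃ H : MvPolynomial σ K, H = ∑ i, C (c' i) * X i := ⟨_, rfl⟩
  obtain ⟨Hf, hHf⟩ : ∃ Hf : MvPolynomial σ K, Hf = ∑ i, C (Function.update c' j 0 i) * X i := ⟨_, rfl⟩
  rw [← hH] at h
  rw [← hHf]
  have hsplit : H = Hf + X j * C (c' j) := by
    rw [hH, hHf, show (∑ i, C (Function.update c' j 0 i) * X i : MvPolynomial σ K) =
        ∑ i, (C (c' i) * X i - if i = j then C (c' j) * X j else 0) from Finset.sum_congr rfl fun i _ => by
          by_cases hij : i = j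
          · subst hij; rw [if_pos rfl, Function.update_self, C_0, zero_mul, sub_self]
          · rw [if_neg hij, Function.update_of_ne hij, sub_zero],
      Finset.sum_sub_distrib, Finset.sum_ite_eq', if_pos (Finset.mem_univ _), mul_comm (X j), sub_add_cancel]
  obtain ⟨R, hR⟩ := add_X_mul_pow j Hf (C (c' j)) γ
  have h2 : X j ^ E * (A + X j * B) = X j ^ E * (monomial S'' r' * Hf ^ γ + X j * (monomial S'' r' * R)) := by
    rw [h, hsplit, hR, show (monomial (S'' + Finsupp.single j E) r' : MvPolynomial σ K) = X j ^ E * monomial S'' r' from by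
      rw [X_pow_eq_monomial, monomial_mul, one_mul, add_comm]]
    ring
  have hA' : ∀ e ∈ (monomial S'' r' * Hf ^ γ).support, e j = 0 :=
    free_mul (free_monomial hS r') (free_pow (by rw [hHf]; exact free_linear _ (Function.update_self ..)) γ)
  ext e
  by_cases hej : e j = 0
  · have h3 := congrArg (coeff (e + Finsupp.single j E)) h2
    rwa [coeff_two_layer_low j E A B hej, coeff_two_layer_low j E _ _ hej] at h3
  · rw [MvPolynomial.notMem_support_iff.mp fun he => hej (hA e he),
      MvPolynomial.notMem_support_iff.mp fun he => hej (hA' e he)]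

/-! #### A1′ — the low layer at a `StaysOnNewest` move is a pure power (three letters) -/

omit [Fintype σ] [DecidableEq σ] [DecidableEq K] in
/-- With three letters `j, j', c`, an exponent vanishing at `j` and `j'` is a multiple of `1_c`. [folklore] -/
theorem eq_single_of_three {j j' c : σ} (hσ : ∀ i, i = j ∨ i = j' ∨ i = c) (hcj : c ≠ j) (hcj' : c ≠ j')
    {g : σ →₀ ℕ} (hgj : g j = 0) (hgj' : g j' = 0) : g = Finsupp.single c (g c) := by
  classical
  ext i
  rcases hσ i with rfl | rfl | rfl
  · rw [hgj, Finsupp.single_eq_of_ne hcj.symm]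
  · rw [hgj', Finsupp.single_eq_of_ne hcj'.symm]
  · rw [Finsupp.single_eq_same]

end AlgebraTangent

end Summit.ResolutionOfSingularities.ResolutionOfSingularities.Theorems.StallVertex
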